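import Mathlib
import HarnessLib
import Summits.Ventures.LatticeQCDFlow.Scaling.AcceptanceVolumeFloorPi

/-!
# LatticeQCDFlow / Scaling — the Kullback–Leibler divergence of a factorised flow is the SUM of the
# block divergences on a GENERAL space (`Measure.pi`): `D(⊗pᵢ ‖ ⊗qᵢ) = Σᵢ D(pᵢ ‖ qᵢ)`

HONEST FRAMING: exact (Metropolis-corrected) sampling algorithms for lattice gauge theory;
figures of merit are autocorrelation/cost numbers at stated couplings and volumes; no
continuum-physics claim.

Venture `LatticeQCDFlow` (cell pub-lqcd), topic `Scaling`; FANOUT row 3 (`s0-u1-a`, S0-B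
implementation A, GEN-12).  NEW WORK of the cell (elementary; one-coordinate Fubini), the third of
the general-space volume laws of `Scaling/AcceptanceVolumeFloorPi` (imported: the `Measure.pi`
density setting, `piDensity_facts`, `integral_mul_prod_erase_pi`; there: `∏ accᵢ ≤ acc(⊗)`,
`ESS(⊗) = ∏ ESSᵢ`) — the training losses ADD over independent blocks.  SETTING: finitely many
blocks `i : ι`, σ-finite reference measures `μ i` on `X i`, POSITIVE integrable block densities
`pᵢ, qᵢ` with `∫ pᵢ = 1` and `pᵢ log(pᵢ/qᵢ) ∈ L¹(μᵢ)`; `P = ⊗pᵢ`, `Q = ⊗qᵢ`.  NO definition is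
introduced (the divergences are written as the Bochner integrals `∫ P log(P/Q) d(⊗μ)`).

* `integrable_mul_prod_erase_pi` — `x ↦ ψ(xⱼ)·∏_{i ≠ j} φᵢ(xᵢ)` is integrable for `Measure.pi μ`
  when `ψ` and the `φᵢ` are (companion of `integral_mul_prod_erase_pi`);
* `log_prod_div_prod` — `log(∏pᵢ(xᵢ)/∏qᵢ(xᵢ)) = Σᵢ log(pᵢ(xᵢ)/qᵢ(xᵢ))` for positive blocks;
* **`integral_mul_log_div_pi`** — `∫ P log(P/Q) d(⊗μ) = Σᵢ ∫ pᵢ log(pᵢ/qᵢ) dμᵢ`: the forward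
  (`D(P‖Q)`, mode-covering) divergence adds; by symmetry of the hypotheses so does the reverse
  (`D(Q‖P)`, the flow's training loss up to `log Z`) — **`integral_mul_log_div_pi'`**;
* `integral_mul_log_div_pi_const` — identical blocks: `D(p^{⊗m} ‖ q^{⊗m}) = m·D(p ‖ q)`.

Reading (value-free): on any configuration space the reverse-KL training loss and the forward KL
of a flow that factorises over independent blocks are the sums of the block values, so at fixed
block quality both grow linearly in the number of blocks while (row 3's companion files) the ESS
and the acceptance decay geometrically.  NOT CLAIMED: any loss value of ours; nothing re-scored.
-/

namespace Summit.Ventures.LatticeQCDFlow.Theory2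

open MeasureTheory Finset

variable {ι : Type*} [Fintype ι] {X : ι → Type*} [∀ i, MeasurableSpace (X i)]
  {μ : (i : ι) → Measure (X i)} [∀ i, SigmaFinite (μ i)]

/-- **Integrability companion of the one-coordinate Fubini**: if `ψ ∈ L¹(μⱼ)` and every
`φᵢ ∈ L¹(μᵢ)`, then `x ↦ ψ(xⱼ)·∏_{i ≠ j} φᵢ(xᵢ)` is integrable for `Measure.pi μ`. [folklore] -/
theorem integrable_mul_prod_erase_pi [DecidableEq ι] (j : ι) {ψ : X j → ℝ}
    {φ : (i : ι) → X i → ℝ} (hψ : Integrable ψ (μ j)) (hφ : ∀ i, Integrable (φ i) (μ i)) :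
    Integrable (fun x : (i : ι) → X i => ψ (x j) * ∏ i ∈ univ.erase j, φ i (x i))
      (Measure.pi μ) := by
  have key : ∀ x : (i : ι) → X i,
      ψ (x j) * ∏ i ∈ univ.erase j, φ i (x i) = ∏ i, Function.update φ j ψ i (x i) := by
    intro x
    rw [← mul_prod_erase univ (fun i => Function.update φ j ψ i (x i)) (mem_univ j),
      Function.update_self]
    congr 1
    exact prod_congr rfl fun i hi => by rw [Function.update_of_ne (ne_of_mem_erase hi)]
  simp_rw [key]
  refine Integrable.fintype_prod_dep fun i => ?_
  by_cases hij : i = j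
  · subst hij
    rw [Function.update_self]
    exact hψ
  · rw [Function.update_of_ne hij]
    exact hφ i

omit [Fintype ι] [∀ i, MeasurableSpace (X i)] in
/-- `log(∏ᵢ pᵢ(xᵢ)/∏ᵢ qᵢ(xᵢ)) = Σᵢ log(pᵢ(xᵢ)/qᵢ(xᵢ))` for positive block densities. [folklore] -/
theorem log_prod_div_prod (s : Finset ι) {p q : (i : ι) → X i → ℝ} (hp0 : ∀ i a, 0 < p i a)
    (hq0 : ∀ i a, 0 < q i a) (x : (i : ι) → X i) :
    Real.log ((∏ i ∈ s, p i (x i)) / ∏ i ∈ s, q i (x i))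
      = ∑ i ∈ s, Real.log (p i (x i) / q i (x i)) := by
  rw [← prod_div_distrib, Real.log_prod]
  intro i _
  exact (div_pos (hp0 i (x i)) (hq0 i (x i))).ne'

/-- **KL IS ADDITIVE OVER INDEPENDENT BLOCKS (general space).**  For positive integrable block
densities with `∫ pᵢ dμᵢ = 1` and `pᵢ log(pᵢ/qᵢ) ∈ L¹(μᵢ)`:
`∫ P log(P/Q) d(⊗μ) = Σᵢ ∫ pᵢ log(pᵢ/qᵢ) dμᵢ`, i.e. `D(⊗pᵢ ‖ ⊗qᵢ) = Σᵢ D(pᵢ ‖ qᵢ)`. [ours] -/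
theorem integral_mul_log_div_pi {p q : (i : ι) → X i → ℝ} (hp0 : ∀ i a, 0 < p i a)
    (hpi : ∀ i, Integrable (p i) (μ i)) (hp1 : ∀ i, ∫ a, p i a ∂(μ i) = 1) (hq0 : ∀ i a, 0 < q i a)
    (hli : ∀ i, Integrable (fun a => p i a * Real.log (p i a / q i a)) (μ i)) :
    ∫ x, (∏ i, p i (x i)) * Real.log ((∏ i, p i (x i)) / ∏ i, q i (x i)) ∂(Measure.pi μ)
      = ∑ i, ∫ a, p i a * Real.log (p i a / q i a) ∂(μ i) := by
  classical
  -- expand the logarithm and pull block `j`'s factor out of the product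
  have hterm : ∀ (j : ι) (x : (i : ι) → X i),
      (∏ i, p i (x i)) * Real.log (p j (x j) / q j (x j))
        = (p j (x j) * Real.log (p j (x j) / q j (x j))) * ∏ i ∈ univ.erase j, p i (x i) := by
    intro j x
    rw [← mul_prod_erase univ (fun i => p i (x i)) (mem_univ j)]
    ring
  have hint : ∀ j : ι, Integrable (fun x : (i : ι) → X i =>
      (∏ i, p i (x i)) * Real.log (p j (x j) / q j (x j))) (Measure.pi μ) := by
    intro j
    simp_rw [hterm j]
    exact integrable_mul_prod_erase_pi j (hli j) hpi
  have hval : ∀ j : ι, ∫ x, (∏ i, p i (x i)) * Real.log (p j (x j) / q j (x j)) ∂(Measure.pi μ)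
      = ∫ a, p j a * Real.log (p j a / q j a) ∂(μ j) := by
    intro j
    simp_rw [hterm j]
    rw [integral_mul_prod_erase_pi j (fun a => p j a * Real.log (p j a / q j a)) (fun i a => p i a),
      prod_eq_one fun i _ => hp1 i, mul_one]
  calc ∫ x, (∏ i, p i (x i)) * Real.log ((∏ i, p i (x i)) / ∏ i, q i (x i)) ∂(Measure.pi μ)
      = ∫ x, ∑ j, (∏ i, p i (x i)) * Real.log (p j (x j) / q j (x j)) ∂(Measure.pi μ) := by
        refine integral_congr_ae (Filter.Eventually.of_forall fun x => ?_)
        show (∏ i, p i (x i)) * Real.log ((∏ i, p i (x i)) / ∏ i, q i (x i))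
          = ∑ j, (∏ i, p i (x i)) * Real.log (p j (x j) / q j (x j))
        rw [log_prod_div_prod univ hp0 hq0 x, mul_sum]
    _ = ∑ j, ∫ x, (∏ i, p i (x i)) * Real.log (p j (x j) / q j (x j)) ∂(Measure.pi μ) :=
        integral_finsetSum _ fun j _ => hint j
    _ = ∑ i, ∫ a, p i a * Real.log (p i a / q i a) ∂(μ i) := sum_congr rfl fun j _ => hval j

/-- **The reverse divergence adds too**: `∫ Q log(Q/P) d(⊗μ) = Σᵢ ∫ qᵢ log(qᵢ/pᵢ) dμᵢ` for
positive integrable blocks with `∫ qᵢ = 1`, `qᵢ log(qᵢ/pᵢ) ∈ L¹` — `D(⊗qᵢ ‖ ⊗pᵢ)`, the flow's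
reverse-KL training loss net of `log Z`, is the sum of the block losses. [ours] -/
theorem integral_mul_log_div_pi' {p q : (i : ι) → X i → ℝ} (hp0 : ∀ i a, 0 < p i a)
    (hq0 : ∀ i a, 0 < q i a) (hqi : ∀ i, Integrable (q i) (μ i)) (hq1 : ∀ i, ∫ a, q i a ∂(μ i) = 1)
    (hli : ∀ i, Integrable (fun a => q i a * Real.log (q i a / p i a)) (μ i)) :
    ∫ x, (∏ i, q i (x i)) * Real.log ((∏ i, q i (x i)) / ∏ i, p i (x i)) ∂(Measure.pi μ)
      = ∑ i, ∫ a, q i a * Real.log (q i a / p i a) ∂(μ i) :=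
  integral_mul_log_div_pi hq0 hqi hq1 hp0 hli

/-! ## Identical blocks -/

section Const

variable {Y : Type*} [MeasurableSpace Y] {ν : Measure Y} [SigmaFinite ν]

/-- **Identical blocks**: `D(p^{⊗m} ‖ q^{⊗m}) = m·D(p ‖ q)`, `m = card ι`. [ours] -/
theorem integral_mul_log_div_pi_const {p q : Y → ℝ} (hp0 : ∀ a, 0 < p a)
    (hpi : Integrable p ν) (hp1 : ∫ a, p a ∂ν = 1) (hq0 : ∀ a, 0 < q a)
    (hli : Integrable (fun a => p a * Real.log (p a / q a)) ν) :
    ∫ x, (∏ i : ι, p (x i)) * Real.log ((∏ i : ι, p (x i)) / ∏ i : ι, q (x i))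
        ∂(Measure.pi fun _ : ι => ν)
      = Fintype.card ι * ∫ a, p a * Real.log (p a / q a) ∂ν := by
  rw [integral_mul_log_div_pi (ι := ι) (X := fun _ => Y) (μ := fun _ : ι => ν) (p := fun _ => p)
    (q := fun _ => q) (fun _ => hp0) (fun _ => hpi) (fun _ => hp1) (fun _ => hq0) (fun _ => hli),
    sum_const, card_univ, nsmul_eq_mul]

end Const

end Summit.Ventures.LatticeQCDFlow.Theory2
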